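/-
Copyright: the b2b-balaban cell (near-miss cell 7), T⁴-continuum fan-out; row NE7b ROUND-2 swarm, seat
t4-ne7b-formalise-leaf-08 (gen 11) — smallness census, finding F-leaf08g11-1 «THE SATURATED COLLAPSE RADIUS» (journal
l.17741); records for row S12n «Θ BUDGET AUDIT» (holder t4-ne7b-formalise-leaf-10 g12).  Released under the licence of
the surrounding project.
-/
import Summits.QuantumFields.BalabanUV.T4Continuum.Support.HistoryZoneMassLawLevels

/-!
# The saturated collapse radius of a levelled tolerant evolution (smallness census, F-leaf08g11-1)

Summits-side support leaf of the T⁴-continuum cell (rung (B)+1 on a FINITE torus only; NOT infinite volume, NOT the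
mass gap, NOT the Clay statement; NOT a proof of the spine estimate NE7b).  Row NE7b, route «COUNT», smallness census
of the cell's OWN constants (rows S12k∕S12m∕S12n).  [folklore] finite combinatorics on OUR evolution model
`HistoryZoneEvolveLevels.evolveD` (leaf-04 g3) under OUR level functions `HistoryZones.LevelFn` (leaf-07 g2); nothing
is quoted from print, nothing printed is asserted, no `[cite:]` tag, no `Prop`-valued fact minted; constants SYMBOLIC in
the collar `c` and the refinement factor `L` (trigger c2∕c6) — numerals appear only in the decided sanity `example`s.

WHY.  In the END of record's class-linear constant `Θ` (`HistoryRealiseCellsRunPinnedT3bP`, the left side of `hθJ`)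
the factor `N := (2·cth 32 1 sS + 1)^d` descends from the zone law AT LEVELS
(`HistoryZoneMassLawLevels.card_zone_le_levels` ∕ `HistoryZoneMassPiecesLaw.card_zone_le_pieces`, `A₁ = (2·cth c 1 s + 1)^d`)
through `HistoryZoneEvolveLevels.card_evolveD_le`, whose collapse lemma `evolveD_subset_thickT_blocks` states the
level-pattern-free radius `cth c 1 k = k·(c+1)` (`cth_one`): it DISCARDS every contraction (its step `hrad` bounds
`cth c 1 k ∕ L^{j} + 1` by `cth c 1 k + 1`).  Under the SAME `LevelFn K lv` the law already binds (rises by at most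
one level per step, plateaus isolated) the EXACT pattern radius saturates: it never exceeds
`csat c L = 2(c+1) + 2(c+1)∕(L−1)`, whatever the number of steps — e.g. `csat 32 13 = 71` against `cth 32 1 34 = 1122`.

WHAT.  §1 **`cthD c L lv u k`** = the exact collapsed radius of `k` levelled tolerant steps from step `u`
(`cthD 0 = 0`, `cthD (k+1) = c + cthD k ∕ L^{lv (u+k+1) − lv (u+k)} + 1`); `cthD_le_cth_one` (it refines the tree's
radius); **`evolveD_subset_thickT_blocks_cthD`** and **`card_evolveD_le_cthD`** (the tree's induction with the
contraction KEPT: `#evolveD u k S ≤ (2·cthD k + 1)^d · #blocks (L^{lv (u+k) − lv u}) S`).  §2 **`csat c L`**; the two-step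
recursion **`cthD_add_two_le`** (`cthD (k+2) ≤ 2(c+1) + cthD k ∕ L`: of two consecutive steps at least one rises);
`csat_absorb` (`2(c+1) + csat ∕ L ≤ csat`, `2 ≤ L`); **`cthD_le_csat`** (`∀ k, cthD k ≤ csat c L` — stride-independent);
**`evolveD_subset_thickT_blocks_sat`**, **`card_evolveD_le_sat`** (`#evolveD u k S ≤ (2·csat c L + 1)^d · #blocks (…) S`).
§3 sizes: `csat_le_four_mul` (`csat ≤ 4(c+1)`), `csat_le_cth_one` (`csat c L ≤ cth c 1 k` from `k = 4` on), `cast_pow_cthD_le`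
(the laws' `hcth` shape), **`cast_csat_le`** (`(csat c L : ℝ) ≤ 2(c+1)·L∕(L−1)`).  §4 sanity
(decided): `csat 32 13 = 71`, `csat 32 4 = 88`, `cth 32 1 34 = 1122`, and the alternating plateau∕rise pattern
`lv t = (t+1)∕2` IS a level function and ATTAINS `71` — the bound of §2 is sharp.

CENSUS EFFECT (numbers in the journal l.17741 and `HOME/t4/b2b-balaban-t4-ne7b-formalise-leaf-08/g11/census/`, two
engines; NOT in this file): replacing `N = 2245⁴` by `143⁴` at `(c, L) = (32, 13)` divides `Θ_min` by `7.9·10⁴` and relaxes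
the stride smallness from `sS ≥ 34` to `sS ≥ 26`.  This file re-plugs NOTHING: the laws, `HistoryZoneMassCluster`,
`…Regions`, the `HistoryJoinsPlaced*` chain and every END keep `cth c 1 s`; a law-level twin with `A₁ := (2·csat c L + 1)^d`
is a separate, optional module.

HONEST: bookkeeping on OUR model; the headline's Prop and its ∃-bound thresholds are unchanged; nothing of H3 ∕ (B) ∕
BetaPertHyp discharged; NE7b NOT proved; spine 0∕9.  HONEST DEPENDENCY (cell): continuum YM on T⁴ ⇐ BetaPertH ∧ nine
spine estimates (0/9 proved); BetaPertH ⇐ (D1) ∧ (D4) ∧ CAP+tail; G-an2-4 gates asym, D1 and NE2/3/4.  This file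
changes none of it.
-/

open Finset
open Literature.MathematicalPhysics.QuantumFieldTheory.Balaban1983to89
open T4PersistenceDictionary T4PartnerMultiplicity
open Summit.QuantumFields.BalabanUV.T4Continuum.PlacementSkeleton
open Summit.QuantumFields.BalabanUV.T4Continuum.Crowding
open Summit.QuantumFields.BalabanUV.T4Continuum.ZoneSkeleton
open Summit.QuantumFields.BalabanUV.T4Continuum.ZoneTorus
open Summit.QuantumFields.BalabanUV.T4Continuum.HistoryZones
open Summit.QuantumFields.BalabanUV.T4Continuum.HistoryZoneMass
open Summit.QuantumFields.BalabanUV.T4Continuum.HistoryZoneEvolve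
open Summit.QuantumFields.BalabanUV.T4Continuum.HistoryZoneEvolveLevels
open Summit.QuantumFields.BalabanUV.T4Continuum.HistoryZoneMassLawLevels

namespace Summit.QuantumFields.BalabanUV.T4Continuum.HistoryZoneEvolveSaturate

noncomputable section

variable {d : ℕ}

/-! ## §1 The exact pattern radius and the collapse lemma with the contractions kept -/

section Exact

/-- **THE EXACT COLLAPSED RADIUS of `k` levelled tolerant steps from step `u`** under the level pattern `lv`:
`cthD 0 = 0`, `cthD (k+1) = c + cthD k ∕ L^{lv (u+k+1) − lv (u+k)} + 1` (a rising step contracts the accumulated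
radius by `L`, a plateau step does not). [folklore] -/
def cthD (c L : ℕ) (lv : ℕ → ℕ) (u : ℕ) : ℕ → ℕ
  | 0 => 0
  | k + 1 => c + (cthD c L lv u k / L ^ (lv (u + k + 1) - lv (u + k)) + 1)

variable {n L K c u : ℕ} {lv : ℕ → ℕ}

/-- no step, no radius [folklore] -/
@[simp] theorem cthD_zero : cthD c L lv u 0 = 0 := rfl

/-- the defining recursion [folklore] -/
theorem cthD_succ (k : ℕ) :
    cthD c L lv u (k + 1) = c + (cthD c L lv u k / L ^ (lv (u + k + 1) - lv (u + k)) + 1) := rfl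

/-- one step thickens by `c + 1`, whatever the pattern [folklore] -/
@[simp] theorem cthD_one : cthD c L lv u 1 = c + 1 := by
  simp [cthD_succ]

/-- a step adds at most `c + 1` to the radius [folklore] -/
theorem cthD_succ_le (k : ℕ) : cthD c L lv u (k + 1) ≤ c + (cthD c L lv u k + 1) := by
  rw [cthD_succ]
  have := Nat.div_le_self (cthD c L lv u k) (L ^ (lv (u + k + 1) - lv (u + k)))
  omega

/-- **THE EXACT RADIUS REFINES THE LEVEL-PATTERN-FREE ONE**: `cthD c L lv u k ≤ cth c 1 k` (`= k·(c+1)`). [folklore] -/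
theorem cthD_le_cth_one : ∀ k : ℕ, cthD c L lv u k ≤ cth c 1 k
  | 0 => le_rfl
  | k + 1 => by
      have ih := cthD_le_cth_one k
      have h1 := cthD_succ_le (c := c) (L := L) (lv := lv) (u := u) k
      rw [HistoryZoneEvolveLevels.cth_one] at ih ⊢
      have : (k + 1) * (c + 1) = c + (k * (c + 1) + 1) := by ring
      omega

/-- **`k` LEVELLED TOLERANT STEPS COLLAPSE INTO ONE BLOCKING BY `L^{lv (u+k) − lv u}` AND ONE THICKENING BY THE EXACT
RADIUS `cthD k`** (for a level function, `L ≥ 1`, `u + k ≤ K`) — the tree's `evolveD_subset_thickT_blocks` with the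
contraction of every rising step KEPT. [folklore] -/
theorem evolveD_subset_thickT_blocks_cthD (hL : 1 ≤ L) (hlv : LevelFn K lv) (u : ℕ) {S : Finset (Fin d → ℕ)}
    (hS : InRange (sideD n L K lv u) S) :
    ∀ k : ℕ, u + k ≤ K →
      evolveD n L K lv c u k S ⊆
        thickT (sideD n L K lv (u + k)) (cthD c L lv u k) (blocks (L ^ (lv (u + k) - lv u)) S)
  | 0, _ => by
      show S ⊆ thickT (sideD n L K lv (u + 0)) 0 (blocks (L ^ (lv (u + 0) - lv u)) S)
      rw [Nat.add_zero, Nat.sub_self, pow_zero, blocks_one]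
      exact subset_thickT 0 hS
  | k + 1, hk => by
      have ih := evolveD_subset_thickT_blocks_cthD hL hlv u hS k (Nat.le_of_succ_le hk)
      set r : ℕ := L ^ (lv (u + k + 1) - lv (u + k)) with hr
      have hr1 : 1 ≤ r := Nat.one_le_pow _ _ hL
      have hsd : sideD n L K lv (u + k) = sideD n L K lv (u + k + 1) * r := sideD_add hlv (k := 1) hk
      have hSe : sideD n L K lv u = sideD n L K lv (u + k + 1) * L ^ (lv (u + k + 1) - lv u) := sideD_add hlv hk
      have hm1 : lv u ≤ lv (u + k) := hlv.monotone (Nat.le_add_right u k)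
      have hm2 : lv (u + k) ≤ lv (u + k + 1) := hlv.mono (u + k)
      have hexp : L ^ (lv (u + k) - lv u) * r = L ^ (lv (u + k + 1) - lv u) := by
        rw [hr, ← pow_add]; congr 1; omega
      have h1 : blocks r (evolveD n L K lv c u k S) ⊆
          thickT (sideD n L K lv (u + k + 1)) (cthD c L lv u k / r + 1)
            (blocks (L ^ (lv (u + k + 1) - lv u)) S) := by
        refine (image_subset_image ih).trans ?_
        rw [hsd]
        refine (blocks_thickT_subset hr1 _ _ _).trans (le_of_eq ?_)
        rw [blocks_blocks, hexp]
      have hR : InRange (sideD n L K lv (u + k + 1)) (blocks (L ^ (lv (u + k + 1) - lv u)) S) :=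
        inRange_blocks (Nat.one_le_pow _ _ hL) (by rw [← hSe]; exact hS)
      have hrad : c + (cthD c L lv u k / r + 1) ≤ cthD c L lv u (k + 1) := by
        rw [cthD_succ, hr]
      show thickT (sideD n L K lv (u + k + 1)) c (blocks r (evolveD n L K lv c u k S)) ⊆ _
      exact ((thickT_mono _ _ h1).trans (thickT_thickT_subset c _ hR)).trans (thickT_mono_radius _ hrad _)

/-- **THE CARDINALITY OF A LEVELLED EVOLUTION, EXACT RADIUS**:
`#evolveD u k S ≤ (2·cthD k + 1)^d · #blocks (L^{lv (u+k) − lv u}) S`. [folklore] -/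
theorem card_evolveD_le_cthD (hL : 1 ≤ L) (hlv : LevelFn K lv) (u : ℕ) {S : Finset (Fin d → ℕ)}
    (hS : InRange (sideD n L K lv u) S) {k : ℕ} (hk : u + k ≤ K) :
    (evolveD n L K lv c u k S).card ≤
      (2 * cthD c L lv u k + 1) ^ d * (blocks (L ^ (lv (u + k) - lv u)) S).card := by
  have hSe : sideD n L K lv u = sideD n L K lv (u + k) * L ^ (lv (u + k) - lv u) := sideD_add hlv hk
  have hR : InRange (sideD n L K lv (u + k)) (blocks (L ^ (lv (u + k) - lv u)) S) :=
    inRange_blocks (Nat.one_le_pow _ _ hL) (by rw [← hSe]; exact hS)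
  exact (card_le_card (evolveD_subset_thickT_blocks_cthD hL hlv u hS k hk)).trans (card_thickT_le _ hR)

end Exact

/-! ## §2 Saturation: under a level function the exact radius never exceeds `csat c L` -/

section Saturate

variable {n L K c u : ℕ} {lv : ℕ → ℕ}

/-- **THE SATURATED COLLAPSE RADIUS** `csat c L = 2(c+1) + 2(c+1)∕(L−1)`: the least solution of the two-step recursion
`2(c+1) + R∕L ≤ R` (natural division). [folklore] -/
def csat (c L : ℕ) : ℕ := 2 * (c + 1) + 2 * (c + 1) / (L - 1)

/-- natural division of a sum: `(x + y) ∕ L ≤ x + y ∕ L` (`L ≥ 1`) [folklore] -/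
theorem add_div_le_add_div (hL : 1 ≤ L) (x y : ℕ) : (x + y) / L ≤ x + y / L := by
  have hL0 : 0 < L := hL
  calc (x + y) / L ≤ (L * x + y) / L :=
        Nat.div_le_div_right (Nat.add_le_add_right (Nat.le_mul_of_pos_left x hL0) y)
    _ = x + y / L := Nat.mul_add_div hL0 x y

/-- **THE TWO-STEP RECURSION**: of two consecutive steps of a level function at least one RISES, so
`cthD (k+2) ≤ 2(c+1) + cthD k ∕ L` (`L ≥ 1`). [folklore] -/
theorem cthD_add_two_le (hL : 1 ≤ L) (hlv : LevelFn K lv) (k : ℕ) :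
    cthD c L lv u (k + 2) ≤ 2 * (c + 1) + cthD c L lv u k / L := by
  have e1 : cthD c L lv u (k + 1) = c + (cthD c L lv u k / L ^ (lv (u + k + 1) - lv (u + k)) + 1) := cthD_succ k
  have e2 : cthD c L lv u (k + 2) =
      c + (cthD c L lv u (k + 1) / L ^ (lv (u + (k + 1) + 1) - lv (u + (k + 1))) + 1) := cthD_succ (k + 1)
  rcases hlv.succ_eq_or (u + k) with hp | hr
  · -- step `k+1` is a plateau: no contraction there, but then step `k+2` rises (plateaus are isolated)
    have hiso : lv (u + k + 2) = lv (u + k + 1) + 1 := hlv.isolated (u + k) hp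
    have hx1 : lv (u + k + 1) - lv (u + k) = 0 := by omega
    have hx2 : lv (u + (k + 1) + 1) - lv (u + (k + 1)) = 1 := by
      rw [show u + (k + 1) + 1 = u + k + 2 by ring, show u + (k + 1) = u + k + 1 by ring]; omega
    rw [hx1, pow_zero, Nat.div_one] at e1
    rw [hx2, pow_one, e1] at e2
    have h3 : (c + (cthD c L lv u k + 1)) / L ≤ (c + 1) + cthD c L lv u k / L := by
      rw [show c + (cthD c L lv u k + 1) = (c + 1) + cthD c L lv u k by ring]
      exact add_div_le_add_div hL _ _
    omega
  · -- step `k+1` rises: it contracts by `L`; step `k+2` adds at most `c + 1`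
    have hx1 : lv (u + k + 1) - lv (u + k) = 1 := by omega
    rw [hx1, pow_one] at e1
    have h2 : cthD c L lv u (k + 2) ≤ c + (cthD c L lv u (k + 1) + 1) := by
      rw [e2]
      have := Nat.div_le_self (cthD c L lv u (k + 1)) (L ^ (lv (u + (k + 1) + 1) - lv (u + (k + 1))))
      omega
    omega

/-- **`csat` ABSORBS THE RECURSION**: `2(c+1) + csat c L ∕ L ≤ csat c L` for `L ≥ 2`. [folklore] -/
theorem csat_absorb (hL : 2 ≤ L) (c : ℕ) : 2 * (c + 1) + csat c L / L ≤ csat c L := by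
  obtain ⟨m, rfl⟩ : ∃ m, L = m + 1 := ⟨L - 1, by omega⟩
  have hm : 0 < m := by omega
  set a : ℕ := 2 * (c + 1) with ha
  have hcs : csat c (m + 1) = a + a / m := by simp [csat, ha]
  rw [hcs]
  set q : ℕ := a / m with hq
  -- `a < (q + 1)·m`, hence `a + q < (q + 1)·(m + 1)` and `(a + q) ∕ (m + 1) ≤ q`
  have h1 : a < q * m + m := by rw [hq]; exact Nat.lt_div_mul_add hm
  have h2 : (a + q) / (m + 1) < q + 1 := by
    rw [Nat.div_lt_iff_lt_mul (by omega)]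
    have : (q + 1) * (m + 1) = q * m + m + (q + 1) := by ring
    omega
  omega

/-- **SATURATION**: for a level function and `L ≥ 2`, the exact radius of ANY number of steps is at most `csat c L`
(stride-independent). [folklore] -/
theorem cthD_le_csat (hL : 2 ≤ L) (hlv : LevelFn K lv) : ∀ k : ℕ, cthD c L lv u k ≤ csat c L
  | 0 => Nat.zero_le _
  | 1 => by
      rw [cthD_one]
      unfold csat
      exact le_trans (Nat.le_mul_of_pos_left (c + 1) two_pos) (Nat.le_add_right _ _)
  | k + 2 => by
      have ih := cthD_le_csat hL hlv k
      have h2 := cthD_add_two_le (c := c) (u := u) (le_of_lt hL) hlv k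
      have h3 := csat_absorb hL c
      have h4 : cthD c L lv u k / L ≤ csat c L / L := Nat.div_le_div_right ih
      omega

/-- **THE SATURATED COLLAPSE**: `k` levelled tolerant steps lie in ONE blocking by `L^{lv (u+k) − lv u}` and ONE
thickening by `csat c L` (level function, `L ≥ 2`, `u + k ≤ K`). [folklore] -/
theorem evolveD_subset_thickT_blocks_sat (hL : 2 ≤ L) (hlv : LevelFn K lv) (u : ℕ) {S : Finset (Fin d → ℕ)}
    (hS : InRange (sideD n L K lv u) S) {k : ℕ} (hk : u + k ≤ K) :
    evolveD n L K lv c u k S ⊆ thickT (sideD n L K lv (u + k)) (csat c L) (blocks (L ^ (lv (u + k) - lv u)) S) :=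
  (evolveD_subset_thickT_blocks_cthD (le_of_lt hL) hlv u hS k hk).trans
    (thickT_mono_radius _ (cthD_le_csat hL hlv k) _)

/-- **THE CARDINALITY OF A LEVELLED EVOLUTION, SATURATED**:
`#evolveD u k S ≤ (2·csat c L + 1)^d · #blocks (L^{lv (u+k) − lv u}) S` — the factor does not grow with `k`. [folklore] -/
theorem card_evolveD_le_sat (hL : 2 ≤ L) (hlv : LevelFn K lv) (u : ℕ) {S : Finset (Fin d → ℕ)}
    (hS : InRange (sideD n L K lv u) S) {k : ℕ} (hk : u + k ≤ K) :
    (evolveD n L K lv c u k S).card ≤ (2 * csat c L + 1) ^ d * (blocks (L ^ (lv (u + k) - lv u)) S).card := by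
  have hL1 : 1 ≤ L := le_of_lt hL
  have hSe : sideD n L K lv u = sideD n L K lv (u + k) * L ^ (lv (u + k) - lv u) := sideD_add hlv hk
  have hR : InRange (sideD n L K lv (u + k)) (blocks (L ^ (lv (u + k) - lv u)) S) :=
    inRange_blocks (Nat.one_le_pow _ _ hL1) (by rw [← hSe]; exact hS)
  exact (card_le_card (evolveD_subset_thickT_blocks_sat hL hlv u hS hk)).trans (card_thickT_le _ hR)

/-- the exact-radius factor is at most the saturated one, as naturals [folklore] -/
theorem pow_cthD_le_pow_csat (hL : 2 ≤ L) (hlv : LevelFn K lv) (k : ℕ) :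
    (2 * cthD c L lv u k + 1) ^ d ≤ (2 * csat c L + 1) ^ d :=
  Nat.pow_le_pow_left (by have := cthD_le_csat (c := c) (u := u) hL hlv k; omega) d

end Saturate

/-! ## §3 Sizes of `csat` -/

section Sizes

variable {L : ℕ}

/-- `csat c L ≤ 4(c+1)` (any `L`) [folklore] -/
theorem csat_le_four_mul (c L : ℕ) : csat c L ≤ 4 * (c + 1) := by
  unfold csat
  have := Nat.div_le_self (2 * (c + 1)) (L - 1)
  omega

/-- `2(c+1) ≤ csat c L` [folklore] -/
theorem two_mul_le_csat (c L : ℕ) : 2 * (c + 1) ≤ csat c L := by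
  unfold csat; exact Nat.le_add_right _ _

/-- from four steps on the saturated radius is never worse than the level-pattern-free one: `csat c L ≤ cth c 1 k` for
`k ≥ 4` [folklore] -/
theorem csat_le_cth_one {k : ℕ} (hk : 4 ≤ k) (c L : ℕ) : csat c L ≤ cth c 1 k := by
  rw [HistoryZoneEvolveLevels.cth_one]
  have h1 := csat_le_four_mul c L
  have h2 : 4 * (c + 1) ≤ k * (c + 1) := Nat.mul_le_mul_right _ hk
  omega

/-- the exact-radius factor against the saturated one, CAST (the shape of the laws' step `hcth`) [folklore] -/
theorem cast_pow_cthD_le {K c u : ℕ} {lv : ℕ → ℕ} (hL : 2 ≤ L) (hlv : LevelFn K lv) (d k : ℕ) :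
    (((2 * cthD c L lv u k + 1) ^ d : ℕ) : ℝ) ≤ (((2 * csat c L + 1) ^ d : ℕ) : ℝ) := by
  exact_mod_cast pow_cthD_le_pow_csat (d := d) hL hlv k

/-- `csat` is monotone in the collar [folklore] -/
theorem csat_mono_collar {c c' : ℕ} (h : c ≤ c') (L : ℕ) : csat c L ≤ csat c' L := by
  unfold csat
  have := Nat.div_le_div_right (c := L - 1) (Nat.mul_le_mul_left 2 (Nat.add_le_add_right h 1))
  omega

/-- **THE REAL SIZE**: `(csat c L : ℝ) ≤ 2(c+1)·L ∕ (L−1)` for `L ≥ 2`. [folklore] -/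
theorem cast_csat_le (hL : 2 ≤ L) (c : ℕ) :
    (csat c L : ℝ) ≤ 2 * ((c : ℝ) + 1) * (L : ℝ) / ((L : ℝ) - 1) := by
  have hL1 : (1 : ℝ) < (L : ℝ) := by exact_mod_cast (lt_of_lt_of_le one_lt_two hL)
  have hpos : (0 : ℝ) < (L : ℝ) - 1 := sub_pos.2 hL1
  have hsub : (((L - 1 : ℕ)) : ℝ) = (L : ℝ) - 1 := by
    rw [Nat.cast_sub (by omega : 1 ≤ L)]; simp
  have hdiv : ((2 * (c + 1) / (L - 1) : ℕ) : ℝ) ≤ (2 * ((c : ℝ) + 1)) / ((L : ℝ) - 1) := by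
    refine (Nat.cast_div_le).trans (le_of_eq ?_)
    rw [hsub]; push_cast; ring
  have hcast : (csat c L : ℝ) = (2 * ((c : ℝ) + 1)) + ((2 * (c + 1) / (L - 1) : ℕ) : ℝ) := by
    unfold csat; push_cast; ring
  rw [hcast]
  calc (2 * ((c : ℝ) + 1)) + ((2 * (c + 1) / (L - 1) : ℕ) : ℝ)
      ≤ (2 * ((c : ℝ) + 1)) + (2 * ((c : ℝ) + 1)) / ((L : ℝ) - 1) := by linarith
    _ = 2 * ((c : ℝ) + 1) * (L : ℝ) / ((L : ℝ) - 1) := by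
        field_simp
        ring

end Sizes

/-! ## §4 Sanity (decided; the only numerals of this file) -/

namespace Sanity

/-- the cell's collar `32` on refinement `13`: the saturated radius is `71` -/
example : csat 32 13 = 71 := by decide

/-- … and `88` on refinement `4` -/
example : csat 32 4 = 88 := by decide

/-- the tree's level-pattern-free radius at the minimal stride `34` for `L = 13` is `1122` -/
example : cth 32 1 34 = 1122 := by decide

/-- the alternating plateau∕rise pattern `lv t = (t+1)∕2` IS a level function (any cutoff) … -/
example (K : ℕ) : LevelFn K (fun t => (t + 1) / 2) :=
  ⟨fun t => by omega, fun t => by omega, fun t _ => by omega, fun t _ => by omega⟩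

/-- … and under it the exact radii for `(c, L) = (32, 13)` run `0, 33, 66, 38, 71, 38, 71`: the bound `csat 32 13 = 71`
of §2 is ATTAINED -/
example : (List.range 7).map (cthD 32 13 (fun t => (t + 1) / 2) 0) = [0, 33, 66, 38, 71, 38, 71] := by decide

/-- on a drop-free life (`lv = id`) every step rises and the exact radius saturates at once: `0, 33, 35, 35, 35` -/
example : (List.range 5).map (cthD 32 13 (fun t => t) 0) = [0, 33, 35, 35, 35] := by decide

end Sanity

end

end Summit.QuantumFields.BalabanUV.T4Continuum.HistoryZoneEvolveSaturate
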